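import Literature.AlgebraicGeometry.AbelianSchemes.AbelianSchemeKOfLClosedSubscheme
import Literature.AlgebraicGeometry.AbelianSchemes.AbelianSchemeKOfLFibres
import Literature.AlgebraicGeometry.AbelianSchemes.RigidifiedLineBundleLimitDescentStage
import Literature.AlgebraicGeometry.AbelianVarieties.HomogeneousLineBundleDivisor
import Mathlib.AlgebraicGeometry.Noetherian
import Mathlib.FieldTheory.IsAlgClosed.AlgebraicClosure
import HarnessLib

/-!
# The `Pic⁰` locus of a rigidified line bundle on an ABELIAN SCHEME over a Noetherian affine base is CLOSED
# (Mumford §8, §13 with the seesaw theorem §10; Milne I §8)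

Layer `Literature/AlgebraicGeometry/AbelianSchemes`, namespace `Literature.AlgebraicGeometry.AbelianSchemes.AbelianSchemeOver`.
THEOREMS ONLY (no definition, no named fact, no instance, no notation, no `sorry`).

Setting: an abelian scheme `A → Spec R` over a NOETHERIAN affine base, a rank-one module `L` on `A` rigidified along the
identity section.  For a geometric point `s : Spec Ω → Spec R` the fibre `A_s` is an abelian variety over `Ω`
(★ `AbelianSchemeOver.fibre` / `toAbelianVariety`) carrying `L_s`, and «`L_s ∈ Pic⁰(A_s)`» is ★ `IsHomogeneous`
([MumfordAV1970] §8 (i): `t_P^*L_s ≅ L_s` for every `P ∈ A_s(Ω)`).  The **`Pic⁰` locus** is the set of scheme points `x` of the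
base such that `L_s ∈ Pic⁰` for EVERY geometric point `s` over `x` (★ `RigidifiedLineBundle.picZeroLocus`, [MilneAV2008] I §8 (a)).

ROAD («open projection through `K(L)`», the any-base replacement of ★ `AbelianVarieties/RigidifiedLineBundlePicZeroLocusClosed`,
which treats the constant family `A₀ × T` over a field by the seesaw trivial locus):
* §1 `exists_comp_eq_of_isClosedImmersion_of_mem_range` — a morphism from the spectrum of a field whose image point lies in
  the image of a closed immersion `i` factors through `i` (Mathlib `IsClosedImmersion.lift`; kernels of morphisms from reduced
  schemes are vanishing ideals of the closure of the image, [Hartshorne1977] II Ex. 3.11 (d));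
* §2 **`isClosed_setOf_forall_isHomogeneous_fibre_of_isNoetherianRing`** — [MumfordAV1970] §13 (p. 123): `K(L) ↪ A` is a CLOSED
  subscheme (★ `exists_isClosedImmersion_iff_memKOfL_of_isNoetherianRing`, the relative seesaw §10 + §5) whose `Ω`-points over
  `s` are the `P ∈ A_s(Ω)` with `t_P^*L_s ≅ L_s` (★ `memKOfL_homMk_iff_phiPic_eq_one`, [MumfordAV1970] §13 «the `k`-valued points
  of `K(L)`»); hence `x ∈` locus ⟺ `π⁻¹(x) ⊆ |K(L)|` (★ `isHomogeneous_iff_forall_pullback_detClass_eq`), i.e. the locus is the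
  complement of `π(A ∖ |K(L)|)`, and `π : A → Spec R` is OPEN (flat of finite presentation, ★ `universallyOpen_hom`) — CLOSED;
* §3 **`isClosed_picZeroLocus_of_isAffine`** — the same for the module of a rigidified line bundle `ℒ` on `A_T` (★
  `RigidifiedLineBundle`), `A/S` any abelian scheme, `T → S` any AFFINE locally Noetherian test scheme (transport along
  `T ≅ Spec Γ(T, 𝒪_T)`, ★ `isHomogeneous_fibre_comapAlong_iff`); `isClosed_picZeroLocus_of_locallyOfFiniteType` — `T` affine of
  finite type over a Noetherian affine `Spec K` (the hypothesis `hclosed` of the limit descent ★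
  `existsUnique_classify_affine_of_finiteType` / its ring-base edition).

Cell `hodgecm-mathlib` (D-0151), FLOOR 0 P1, F-3 (M) grandchild line `Cruxes/HDel/Lines/F3DualAbelianSchemeMc`, node N0′ (0d)
«affine finite type ⇒ affine» over a Noetherian base: the closedness input of the limit descent of the `Pic⁰` condition to a
finite-type stage.  Count-neutral; HC_CM is proved only modulo the 7 printed citations until rung 0 closes; nothing here is about HC.

Mathlib searched (pin): `IsClosedImmersion.lift` / `lift_fac`, `Scheme.Hom.support_ker`, `Scheme.IdealSheafData.vanishingIdeal_*`,
`quasiSeparatedSpace_of_quasiSeparated`, `LocallyOfFiniteType.isLocallyNoetherian`, `isLocallyNoetherian_Spec` (used); Mathlib has no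
abelian schemes.

## References
* [MumfordAV1970] D. Mumford, *Abelian Varieties* (1970), §8 ((iv) ⇔ (i), pp. 74–80), §10 (p. 89), §13 (p. 123).
* [MilneAV2008] J. S. Milne, *Abelian Varieties* (v2.00, 2008), I §8 pp. 36–37.
* [GortzWedhorn2023] U. Görtz, T. Wedhorn, *Algebraic Geometry II* (2023), Thm. 24.66 (p. 405; proof pp. 407–408).
* [Hartshorne1977] R. Hartshorne, *Algebraic Geometry* (1977), II Ex. 3.11 (d).
* [GortzWedhorn2020] U. Görtz, T. Wedhorn, *Algebraic Geometry I*, 2nd ed. (2020), Section (4.7) (pp. 107–108), Prop. 3.27.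
-/

noncomputable section

-- `Scheme.Modules` / `SheafOfModules` are not reducible; `(A.X ⊗ Over.mk s).left = pullback A.X.hom s` holds by `rfl` only.
set_option backward.isDefEq.respectTransparency false

universe u

open CategoryTheory CategoryTheory.Limits AlgebraicGeometry MonoidalCategory CartesianMonoidalCategory
open scoped MonObj

namespace Literature.AlgebraicGeometry.AbelianSchemes

namespace AbelianSchemeOver

open Literature.AlgebraicGeometry.Motives Literature.AlgebraicGeometry.AbelianVarieties Literature.AlgebraicGeometry.Modules

/-! ### §1 Field-valued points with image in a closed subscheme factor through it -/

/-- **A morphism from the spectrum of a field whose image point lies in the image of a closed immersion `i : Z → X` factors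
through `i`** (`X` quasi-separated): the kernel of `i` is contained in the kernel of `t : Spec Ω → X`, the latter being the vanishing
ideal sheaf of `{x}⁻ ⊆ i(Z)` (Mathlib `IsClosedImmersion.lift`). [cite: Hartshorne1977, II Ex. 3.11 (d)] [cite: GortzWedhorn2020, Prop. 3.27] -/
theorem exists_comp_eq_of_isClosedImmersion_of_mem_range {X Z : Scheme.{u}} [QuasiSeparatedSpace X] (i : Z ⟶ X)
    [IsClosedImmersion i] {Ω : Type u} [Field Ω] (t : Spec (.of Ω) ⟶ X)
    (ht : t.base (IsLocalRing.closedPoint Ω) ∈ Set.range i.base) :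
    ∃ t' : Spec (.of Ω) ⟶ Z, t' ≫ i = t := by
  -- the kernel of `t` is the vanishing ideal of the closure of its image (reduced source)
  have hrad : t.ker.radical = t.ker := by
    ext U : 2
    rw [Scheme.IdealSheafData.radical_ideal, Scheme.Hom.ker_apply]
    refine (Ideal.IsRadical.radical fun s ⟨n, hn⟩ ↦ ?_)
    rw [RingHom.mem_ker] at hn ⊢
    rw [map_pow] at hn
    exact IsReduced.eq_zero _ ⟨n, hn⟩
  have hkt : t.ker = Scheme.IdealSheafData.vanishingIdeal ⟨closure (Set.range t.base), isClosed_closure⟩ := by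
    have hsupp : t.ker.support = ⟨closure (Set.range t.base), isClosed_closure⟩ :=
      TopologicalSpace.Closeds.ext (Scheme.Hom.support_ker t)
    rw [← hsupp, Scheme.IdealSheafData.vanishingIdeal_support, hrad]
  have hki : i.ker ≤ Scheme.IdealSheafData.vanishingIdeal ⟨closure (Set.range i.base), isClosed_closure⟩ := by
    have hsupp : i.ker.support = ⟨closure (Set.range i.base), isClosed_closure⟩ :=
      TopologicalSpace.Closeds.ext (Scheme.Hom.support_ker i)
    rw [← hsupp, Scheme.IdealSheafData.vanishingIdeal_support]
    exact Scheme.IdealSheafData.le_radical _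
  have hle : i.ker ≤ t.ker := by
    rw [hkt]
    refine hki.trans (Scheme.IdealSheafData.vanishingIdeal_antimono ?_)
    change closure (Set.range t.base) ⊆ closure (Set.range i.base)
    refine closure_minimal ?_ isClosed_closure
    rintro _ ⟨s, rfl⟩
    obtain rfl : s = IsLocalRing.closedPoint Ω := Subsingleton.elim _ _
    exact subset_closure ht
  exact ⟨IsClosedImmersion.lift i t hle, IsClosedImmersion.lift_fac i t hle⟩

/-! ### §2 The `Pic⁰` locus of a rigidified rank-one module on an abelian scheme over `Spec R`, `R` Noetherian, is closed -/

section SpecBase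

variable {R : Type} [CommRing R] [IsNoetherianRing R] (A : AbelianSchemeOver (Spec (.of R)))

omit [IsNoetherianRing R] in
/-- **The `Ω`-points of `K(L)` over a geometric point `s` are the `P ∈ A_s(Ω)` with `t_P^*[L_s] = [L_s]`** — in the form «the
point of `A` under `P` lies in the closed subscheme `Z = K(L)`» ([MumfordAV1970] §13: «the `k`-valued points of `K(L)` form the
group `K(L)` of §6»; ★ `memKOfL_homMk_iff_phiPic_eq_one` + §1). [cite: MumfordAV1970, §13 (p. 123) and §6 Definition (p. 60)] -/
theorem fibrePointToLeft_mem_range_iff_pullback_translation_eq {L : A.left.Modules} (hL : HasRank L 1)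
    {Z : Over (Spec (.of R))} (i : Z ⟶ A.X) [IsClosedImmersion i.left]
    (hZ : ∀ (T : Over (Spec (.of R))) (u : T ⟶ A.X), (∃ v : T ⟶ Z, v ≫ i = u) ↔ A.MemKOfL L u)
    {Ω : Type} [Field Ω] (s : Spec (.of Ω) ⟶ Spec (.of R)) (P : (A.fibre s).toAbelianVariety.Points Ω) :
    (A.fibrePointToLeft s P).base (IsLocalRing.closedPoint Ω) ∈ Set.range i.left.base ↔
      CechPic.pullback ((A.fibre s).toAbelianVariety.translation P).left
          (CechPic.pullback (X := (A.fibre s).toAbelianVariety.X.left) (pullback.fst A.X.hom s)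
            (detClass (HasRank.isFiniteLocallyFree' hL))) =
        CechPic.pullback (X := (A.fibre s).toAbelianVariety.X.left) (pullback.fst A.X.hom s)
          (detClass (HasRank.isFiniteLocallyFree' hL)) := by
  haveI : IsProper A.X.hom := A.isProper
  haveI : QuasiSeparatedSpace A.left := quasiSeparatedSpace_of_quasiSeparated A.X.hom
  rw [← phiPic_eq_one_iff, ← A.memKOfL_homMk_iff_phiPic_eq_one s hL P, ← hZ]
  constructor
  · intro h
    obtain ⟨t', ht'⟩ := exists_comp_eq_of_isClosedImmersion_of_mem_range i.left (A.fibrePointToLeft s P) h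
    refine ⟨Over.homMk t' ?_, Over.OverMorphism.ext ht'⟩
    change t' ≫ Z.hom = s
    rw [← Over.w i, ← Category.assoc, ht']
    exact A.fibrePointToLeft_comp_hom s P
  · rintro ⟨v, hv⟩
    refine ⟨v.left.base (IsLocalRing.closedPoint Ω), ?_⟩
    rw [← Scheme.Hom.comp_apply, ← Over.comp_left, hv]
    rfl

/-- **The `Pic⁰` locus is CLOSED** for a rank-one module `L` on an abelian scheme `A → Spec R` (`R` Noetherian) rigidified along the
identity section: the set of points `x` of `Spec R` such that for EVERY geometric point `s : Spec Ω → Spec R` over `x` the fibre `L_s`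
is homogeneous on the abelian variety `A_s` (★ `IsHomogeneous`, [MumfordAV1970] §8 (i)) is closed.  Proof: `K(L) ↪ A` is a closed
subscheme ([MumfordAV1970] §13 with the relative seesaw §10, ★ `exists_isClosedImmersion_iff_memKOfL_of_isNoetherianRing`); by
`fibrePointToLeft_mem_range_iff_pullback_translation_eq` and ★ `isHomogeneous_iff_forall_pullback_detClass_eq`, `x ∈` locus ⟺
`π⁻¹(x) ⊆ |K(L)|`; so the locus is the complement of `π(A ∖ |K(L)|)`, open because `π : A → Spec R` is universally open.
[cite: MumfordAV1970, §8 ((iv) ⇔ (i), pp. 74–80) and §13 (p. 123)] [cite: GortzWedhorn2023, Thm. 24.66 (p. 405; proof pp. 407–408)] -/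
theorem isClosed_setOf_forall_isHomogeneous_fibre_of_isNoetherianRing {L : A.left.Modules} (hL : HasRank L 1)
    (hε : Nonempty ((Scheme.Modules.pullback A.unitSection).obj L ≅ SheafOfModules.unit _)) :
    IsClosed {x : ↥(Spec (.of R)) | ∀ (Ω : Type) [Field Ω] [IsAlgClosed Ω] (s : Spec (.of Ω) ⟶ Spec (.of R)),
      s.base (IsLocalRing.closedPoint Ω) = x →
        IsHomogeneous (A.fibre s).toAbelianVariety ((Scheme.Modules.pullback (pullback.fst A.X.hom s)).obj L)} := by
  -- `K(L)` is a closed subscheme of `A`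
  obtain ⟨Z, i, hi, hZ⟩ := A.exists_isClosedImmersion_iff_memKOfL_of_isNoetherianRing hL
    (A.pullback_unitSection_detClass_eq_one hL hε)
  haveI : IsProper A.X.hom := A.isProper
  haveI : UniversallyOpen A.X.hom := A.universallyOpen_hom
  have hpr : IsOpenMap A.X.hom.base := A.X.hom.isOpenMap
  have hZc : IsClosed (Set.range i.left.base) := i.left.isClosedEmbedding.isClosed_range
  have hM : IsFiniteLocallyFree L := HasRank.isFiniteLocallyFree' hL
  -- the locus is the complement of `π (A ∖ |K(L)|)`
  have hS : {x : ↥(Spec (.of R)) | ∀ (Ω : Type) [Field Ω] [IsAlgClosed Ω] (s : Spec (.of Ω) ⟶ Spec (.of R)),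
      s.base (IsLocalRing.closedPoint Ω) = x →
        IsHomogeneous (A.fibre s).toAbelianVariety ((Scheme.Modules.pullback (pullback.fst A.X.hom s)).obj L)} =
      (A.X.hom.base '' (Set.range i.left.base)ᶜ)ᶜ := by
    ext x
    simp only [Set.mem_setOf_eq, Set.mem_compl_iff, Set.mem_image, not_exists, not_and]
    constructor
    · -- `⊆`: a point `z ∉ |K(L)|` over `x` contradicts homogeneity at the geometric point `κ(z)^alg` over `x`
      intro hx z hz hzx
      apply hz
      -- the geometric point of `A` through `z`
      obtain ⟨w₀, hw₀z⟩ := RigidifiedLineBundle.exists_geomPoint_over (T := A.left) z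
      set Ω := AlgebraicClosure (A.left.residueField z)
      -- its base point `s`, a geometric point of `Spec R` over `x`
      let s : Spec (.of Ω) ⟶ Spec (.of R) := w₀ ≫ A.X.hom
      have hs : s.base (IsLocalRing.closedPoint Ω) = x := by
        change (w₀ ≫ A.X.hom).base (IsLocalRing.closedPoint Ω) = x
        rw [Scheme.Hom.comp_apply, hw₀z, hzx]
      -- homogeneity of the fibre over `s`, read on classes
      have hhom := (isHomogeneous_iff_forall_pullback_detClass_eq (A.fibre s).toAbelianVariety (hasRank_pullback _ hL)
        (hM.pullback (pullback.fst A.X.hom s))).1 (hx Ω s hs)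
      -- the partner `Ω`-point of the fibre
      let u : A.FibrePoints s := Over.homMk w₀ rfl
      obtain ⟨P, hP⟩ := A.exists_points_fibrePointToLeft_eq s u
      have h1 := hhom P
      rw [detClass_pullback (pullback.fst A.X.hom s) hM] at h1
      have h2 := (A.fibrePointToLeft_mem_range_iff_pullback_translation_eq hL i hZ s P).2 h1
      rw [hP] at h2
      change w₀.base (IsLocalRing.closedPoint Ω) ∈ Set.range i.left.base at h2
      rwa [hw₀z] at h2
    · -- `⊇`: if `π⁻¹(x) ⊆ |K(L)|`, every geometric fibre over `x` is homogeneous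
      intro hx Ω _ _ s hsx
      refine (isHomogeneous_iff_forall_pullback_detClass_eq (A.fibre s).toAbelianVariety (hasRank_pullback _ hL)
        (hM.pullback (pullback.fst A.X.hom s))).2 fun P => ?_
      rw [detClass_pullback (pullback.fst A.X.hom s) hM]
      refine (A.fibrePointToLeft_mem_range_iff_pullback_translation_eq hL i hZ s P).1 ?_
      -- the point of `A` under `P` lies over `x`, hence in `|K(L)|`
      by_contra hz
      refine hx _ hz ?_
      rw [← Scheme.Hom.comp_apply, A.fibrePointToLeft_comp_hom s P]
      exact hsx
  rw [hS]
  exact (hpr _ hZc.isOpen_compl).isClosed_compl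

/-- **The `Pic⁰` locus of a rigidified line bundle on `A_{Spec B}` is closed**, for `A/S` any abelian scheme and a test morphism
`f : Spec B → S` with `B` NOETHERIAN (§2 for the abelian scheme `A_{Spec B} → Spec B` and the module `ℒ.L`).
[cite: MumfordAV1970, §8 ((iv) ⇔ (i), pp. 74–80) and §13 (p. 123)] [cite: MilneAV2008, I §8 pp. 36–37] -/
theorem isClosed_picZeroLocus_of_isNoetherianRing {S : Scheme.{0}} (A : AbelianSchemeOver S) {B : Type} [CommRing B]
    [IsNoetherianRing B] (f : Spec (.of B) ⟶ S) (ℒ : A.RigidifiedLineBundle f) : IsClosed ℒ.picZeroLocus :=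
  (A.baseChange f).isClosed_setOf_forall_isHomogeneous_fibre_of_isNoetherianRing ℒ.hasRank_one ℒ.rigid

end SpecBase

/-! ### §3 Any AFFINE locally Noetherian test scheme -/

section AffineBase

variable {S T : Scheme.{0}} (A : AbelianSchemeOver S) (f : T ⟶ S)

/-- **The `Pic⁰` locus along an isomorphism of test schemes**: for `w : T₁ ≅ T` over `S`, the `Pic⁰` locus of `ℒ` is the preimage
under `w⁻¹` … read: `x ∈` locus of `ℒ` iff `w⁻¹… ` — precisely `ℒ.picZeroLocus = w.inv ⁻¹' (ℒ.comapAlong w.hom hw).picZeroLocus`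
(geometric points over `x` and over `w⁻¹(x)` correspond by composition; ★ `isHomogeneous_fibre_comapAlong_iff`).
[cite: MumfordAV1970, §8 ((iv) ⇔ (i))] [cite: MilneAV2008, I §8 pp. 36–37] -/
theorem picZeroLocus_eq_preimage_picZeroLocus_comapAlong {T₁ : Scheme.{0}} {f₁ : T₁ ⟶ S} (ℒ : A.RigidifiedLineBundle f)
    (w : T₁ ≅ T) (hw : w.hom ≫ f = f₁) :
    ℒ.picZeroLocus = w.inv.base ⁻¹' (ℒ.comapAlong w.hom hw).picZeroLocus := by
  have h₁ : ∀ y : ↥T, w.hom.base (w.inv.base y) = y := fun y => by simp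
  have h₂ : ∀ y : ↥T₁, w.inv.base (w.hom.base y) = y := fun y => by simp
  ext x
  simp only [Set.mem_preimage, RigidifiedLineBundle.mem_picZeroLocus_iff]
  constructor
  · intro hx Ω _ _ t ht
    refine (ℒ.isHomogeneous_fibre_comapAlong_iff w.hom hw Ω t).2 (hx Ω (t ≫ w.hom) ?_)
    rw [Scheme.Hom.comp_apply, ht, h₁]
  · intro hx Ω _ _ t₁ ht₁
    obtain ⟨t, rfl⟩ : ∃ t : Spec (.of Ω) ⟶ T₁, t ≫ w.hom = t₁ := ⟨t₁ ≫ w.inv, by simp⟩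
    refine (ℒ.isHomogeneous_fibre_comapAlong_iff w.hom hw Ω t).1 (hx Ω t ?_)
    rw [← ht₁, Scheme.Hom.comp_apply, h₂]

/-- **The `Pic⁰` locus of a rigidified line bundle on `A_T` is CLOSED for every AFFINE locally Noetherian test scheme `T → S`**
(`A/S` any abelian scheme): transport along `T ≅ Spec Γ(T, 𝒪_T)` (Mathlib `Scheme.isoSpec`; `Γ(T, 𝒪_T)` is Noetherian, Mathlib
`isLocallyNoetherian_Spec`) of `isClosed_picZeroLocus_of_isNoetherianRing`. [cite: MumfordAV1970, §8 ((iv) ⇔ (i), pp. 74–80) and §13 (p. 123)]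
[cite: MilneAV2008, I §8 pp. 36–37] -/
theorem isClosed_picZeroLocus_of_isAffine [IsAffine T] [IsLocallyNoetherian T] (ℒ : A.RigidifiedLineBundle f) :
    IsClosed ℒ.picZeroLocus := by
  haveI : IsLocallyNoetherian (Spec Γ(T, ⊤)) := isLocallyNoetherian_of_isOpenImmersion T.isoSpec.inv
  haveI : IsNoetherianRing Γ(T, ⊤) := isLocallyNoetherian_Spec.mp inferInstance
  have hw : T.isoSpec.inv ≫ f = T.isoSpec.inv ≫ f := rfl
  rw [A.picZeroLocus_eq_preimage_picZeroLocus_comapAlong f ℒ T.isoSpec.symm hw]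
  exact (A.isClosed_picZeroLocus_of_isNoetherianRing (B := Γ(T, ⊤)) (T.isoSpec.inv ≫ f)
    (ℒ.comapAlong T.isoSpec.inv hw)).preimage T.isoSpec.hom.continuous

/-- **The `Pic⁰` locus is closed over every AFFINE base OF FINITE TYPE over a Noetherian affine `Spec K`** — the closedness input
`hclosed` of the limit descent «affine finite type ⇒ affine» (★ `existsUnique_classify_affine_of_finiteType` and its ring-base
edition) for EVERY abelian scheme `A → Spec K` (`T` is locally Noetherian, Mathlib `LocallyOfFiniteType.isLocallyNoetherian`).
[cite: MumfordAV1970, §8 ((iv) ⇔ (i), pp. 74–80) and §13 (proof of the Thm. p. 125)] [cite: MilneAV2008, I §8 pp. 36–37] -/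
theorem isClosed_picZeroLocus_of_locallyOfFiniteType {K : Type} [CommRing K] [IsNoetherianRing K]
    (A : AbelianSchemeOver (Spec (.of K))) (T : Scheme.{0}) [IsAffine T] (f : T ⟶ Spec (.of K)) [LocallyOfFiniteType f]
    (ℒ : A.RigidifiedLineBundle f) : IsClosed ℒ.picZeroLocus :=
  haveI : IsLocallyNoetherian T := LocallyOfFiniteType.isLocallyNoetherian f
  A.isClosed_picZeroLocus_of_isAffine f ℒ

end AffineBase

end AbelianSchemeOver

end Literature.AlgebraicGeometry.AbelianSchemes

end
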